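import Summits.Ventures.AbcSig.Rows.TemplateC2a
import Summits.Ventures.AbcSig.Levels.N67
import Summits.Ventures.AbcSig.Levels.N134

/-!
# Venture AbcSig — ROW `C2aL67A6eq`: `xⁿ + 2^a·67^m·yⁿ = z²`, class `a 6` (GENERATED by plean/leanrow.py)

HONEST FRAMING. A row of a COMPUTATION cell (`pub-abcsig`); a CONDITIONAL theorem, no claim on ABC or any summit.
Hypotheses: `BS04Package` (CITED), `DataComplete` at levels [67, 134] (COMPUTED, two-engine certified
level files), and the listed per-orbit exclusions `hX_…` (CITED — e.g. the cell's M6 Eisenstein certificates; the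
row's R5 cell names each). Everything else is kernel-checked (`Rows/TemplateC2a.lean`, `Levels/N….lean`). Exponent
range: prime `n ≥ 11`, `n ≠ 67`; `B = 2^a 67^m` with `a, m < n` (n-th-power free).
Row of record:  (sha256 ; SIGNED 2026-08-22T08:50:29Z by referee (ref-g4)); its R0: THEOREM (uses CITED arithmetic facts) for all primes n >= 11 with n coprime to 4288 — class: R-a COMPLETION candidate (closes a printed BS04 Thm 1.3 exception o. Exponents left open by the row of record are excluded here via ; kernel-sieve residuals the row of record closes by a cell module (M6 Eisenstein / M4 Kraus certificates) appear as CITED hypotheses .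
-/

namespace Summit.Ventures.AbcSig

/-- Row `C2aL67A6eq` (see module docstring). -/
theorem row_C2aL67A6eq (M : NewformModel) (hP : M.BS04Package)
    (hD67 : M.DataComplete 67 level67Orbits) (hD134 : M.DataComplete 134 level134Orbits)
    (n : ℕ) (hn : n.Prime) (hmin : 11 ≤ n) (hnℓ : n ≠ 67) (m : ℕ) (hm : 1 ≤ m) (hmn : m < n)
    (hX_orbit_67_1 : n ∈ ([7, 11] : List ℕ) → M.Excludes 67 orbit_67_1 (famB (2 ^ 6 * 67 ^ m) n (fun _ _ => True)))
    (hX_orbit_67_2 : n ∈ ([11] : List ℕ) → M.Excludes 67 orbit_67_2 (famB (2 ^ 6 * 67 ^ m) n (fun _ _ => True)))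
    (hX_orbit_134_1 : n ∈ ([17] : List ℕ) → M.Excludes 134 orbit_134_1 (famB (2 ^ 6 * 67 ^ m) n (fun _ _ => True)))
    (x y z : ℤ) (hxy1 : x * y ≠ 1) (hxy2 : x * y ≠ -1) : ¬ IsPrimitiveSolution 1 (2 ^ 6 * 67 ^ m) 1 n x y z := by
  have hℓ : Nat.Prime 67 := by norm_num
  have h7 : 7 ≤ n := by omega
  have hS67 :=
    (level67_sieve n hn h7 (fun o => M.Excludes 67 o (famB (2 ^ 6 * 67 ^ m) n (fun _ _ => True))) hX_orbit_67_1 hX_orbit_67_2)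
  have hS134 :=
    (level134_sieve n hn h7 (fun o => M.Excludes 134 o (famB (2 ^ 6 * 67 ^ m) n (fun _ _ => True))) hX_orbit_134_1)
  exact rowC2a_a6 67 hℓ (by norm_num) M hP n hn h7 hnℓ hD67 hD134 m hm hmn
    hS67
    hS134 x y z hxy1 hxy2

end Summit.Ventures.AbcSig
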